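import Literature.Analysis.Matrix.FiniteRangeDecompositionPow
import HarnessLib

/-!
# Finite-range decomposition with smoother pieces: symmetries of `A` are symmetries of every piece

`Literature/Analysis/Matrix/`; a small functoriality complement of `FiniteRangeDecompositionPow.lean`
(and of `FiniteRangeDecomposition.lean`).  The pieces `C_N = frdPiece A N`, `C^{(m)}_N = frdPiecePow A m N`
and the remainders are built from `A` by `ℝ`-algebra operations only (`B = 1 − A/2`, polynomials in
`B`, products, sums, scalars), hence

* `map_frdCos`, `map_frdPiece`, `map_frdRemainder`, `map_frdPiecePow`, `map_frdRemainderPow`: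
  every `ℝ`-algebra homomorphism `f` of matrix algebras satisfies `f (C^{(m)}_N(A)) = C^{(m)}_N(f A)`;
* `reindex_frdPiecePow`, `frdPiecePow_apply_equiv` (and the `frdPiece` versions): **a relabelling
  `σ` of the index set leaving `A` invariant (`A (σ i) (σ j) = A i j`) leaves every piece invariant**,
  `C^{(m)}_N (σ i) (σ j) = C^{(m)}_N i j` — e.g. the time reflection of a space-time torus for a
  reflection-invariant `A`, so that the scale-`N` fluctuation covariances inherit the reflection
  symmetry (the input of `MultivariateGaussianReindex` / positivity by continuity for
  reflection-symmetric data).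

Everything is proved. [folklore]
-/

noncomputable section

open Finset Polynomial

namespace Literature.Analysis.Matrix

variable {V W : Type*} [Fintype V] [DecidableEq V] [Fintype W] [DecidableEq W]

/-! ### Algebra homomorphisms commute with the construction of the pieces -/

section Map

variable (f : _root_.Matrix V V ℝ →ₐ[ℝ] _root_.Matrix W W ℝ) (A : _root_.Matrix V V ℝ)

/-- `f (1 − A/2) = 1 − (f A)/2`. [folklore] -/
theorem map_frdCos : f (frdCos A) = frdCos (f A) := by
  simp [frdCos, map_sub, map_one, map_smul]

/-- `f (C_N(A)) = C_N(f A)`. [folklore] -/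
theorem map_frdPiece (N : ℕ) : f (frdPiece A N) = frdPiece (f A) N := by
  simp [frdPiece, map_smul, map_pow, ← aeval_algHom_apply, map_frdCos]

/-- `f (R_J(A)) = R_J(f A)`. [folklore] -/
theorem map_frdRemainder (J : ℕ) : f (frdRemainder A J) = frdRemainder (f A) J := by
  simp [frdRemainder, map_smul, ← aeval_algHom_apply, map_frdCos]

/-- `f (C^{(m)}_N(A)) = C^{(m)}_N(f A)`. [folklore] -/
theorem map_frdPiecePow (m N : ℕ) : f (frdPiecePow A m N) = frdPiecePow (f A) m N := by
  simp [frdPiecePow, map_smul, map_mul, map_pow, map_sum, ← aeval_algHom_apply, map_frdCos]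

/-- `f (R^{(m)}_J(A)) = R^{(m)}_J(f A)`. [folklore] -/
theorem map_frdRemainderPow (m J : ℕ) : f (frdRemainderPow A m J) = frdRemainderPow (f A) m J := by
  simp [frdRemainderPow, map_pow, ← aeval_algHom_apply, map_frdCos]

end Map

/-! ### Relabellings leaving `A` invariant leave every piece invariant -/

section Reindex

variable {A : _root_.Matrix V V ℝ} (σ : V ≃ V)

omit [Fintype V] [DecidableEq V] in
/-- Invariance of `A` under the relabelling `σ`, in `reindex` form. [folklore] -/
theorem reindex_eq_self_of_apply_equiv (hσ : ∀ i j, A (σ i) (σ j) = A i j) :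
    _root_.Matrix.reindex σ σ A = A := by
  ext i j
  rw [Matrix.reindex_apply, Matrix.submatrix_apply]
  conv_rhs => rw [← σ.apply_symm_apply i, ← σ.apply_symm_apply j]
  exact (hσ _ _).symm

/-- **`C^{(m)}_N` inherits the symmetry**: `reindex σ σ (C^{(m)}_N(A)) = C^{(m)}_N(A)`. [folklore] -/
theorem reindex_frdPiecePow (hσ : ∀ i j, A (σ i) (σ j) = A i j) (m N : ℕ) :
    _root_.Matrix.reindex σ σ (frdPiecePow A m N) = frdPiecePow A m N := by
  have h := map_frdPiecePow (Matrix.reindexAlgEquiv ℝ ℝ σ).toAlgHom A m N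
  simp only [AlgEquiv.coe_toAlgHom, Matrix.coe_reindexAlgEquiv] at h
  rw [h, reindex_eq_self_of_apply_equiv σ hσ]

/-- Entrywise form: `C^{(m)}_N (σ i) (σ j) = C^{(m)}_N i j`. [folklore] -/
theorem frdPiecePow_apply_equiv (hσ : ∀ i j, A (σ i) (σ j) = A i j) (m N : ℕ) (i j : V) :
    frdPiecePow A m N (σ i) (σ j) = frdPiecePow A m N i j := by
  have h := congrFun (congrFun (reindex_frdPiecePow σ hσ m N) (σ i)) (σ j)
  rw [Matrix.reindex_apply, Matrix.submatrix_apply, σ.symm_apply_apply, σ.symm_apply_apply] at h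
  exact h.symm

/-- `C_N` inherits the symmetry: `reindex σ σ (C_N(A)) = C_N(A)`. [folklore] -/
theorem reindex_frdPiece (hσ : ∀ i j, A (σ i) (σ j) = A i j) (N : ℕ) :
    _root_.Matrix.reindex σ σ (frdPiece A N) = frdPiece A N := by
  have h := map_frdPiece (Matrix.reindexAlgEquiv ℝ ℝ σ).toAlgHom A N
  simp only [AlgEquiv.coe_toAlgHom, Matrix.coe_reindexAlgEquiv] at h
  rw [h, reindex_eq_self_of_apply_equiv σ hσ]

/-- Entrywise form: `C_N (σ i) (σ j) = C_N i j`. [folklore] -/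
theorem frdPiece_apply_equiv (hσ : ∀ i j, A (σ i) (σ j) = A i j) (N : ℕ) (i j : V) :
    frdPiece A N (σ i) (σ j) = frdPiece A N i j := by
  have h := congrFun (congrFun (reindex_frdPiece σ hσ N) (σ i)) (σ j)
  rw [Matrix.reindex_apply, Matrix.submatrix_apply, σ.symm_apply_apply, σ.symm_apply_apply] at h
  exact h.symm

/-- The remainders inherit the symmetry as well. [folklore] -/
theorem reindex_frdRemainderPow (hσ : ∀ i j, A (σ i) (σ j) = A i j) (m J : ℕ) :
    _root_.Matrix.reindex σ σ (frdRemainderPow A m J) = frdRemainderPow A m J := by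
  have h := map_frdRemainderPow (Matrix.reindexAlgEquiv ℝ ℝ σ).toAlgHom A m J
  simp only [AlgEquiv.coe_toAlgHom, Matrix.coe_reindexAlgEquiv] at h
  rw [h, reindex_eq_self_of_apply_equiv σ hσ]

/-- Scalar multiples keep the symmetry (the covariances `t • C^{(m)}_N`). [folklore] -/
theorem smul_frdPiecePow_apply_equiv (hσ : ∀ i j, A (σ i) (σ j) = A i j) (t : ℝ) (m N : ℕ)
    (i j : V) : (t • frdPiecePow A m N) (σ i) (σ j) = (t • frdPiecePow A m N) i j := by
  simp only [Matrix.smul_apply, frdPiecePow_apply_equiv σ hσ]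

end Reindex

end Literature.Analysis.Matrix
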